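import Summits.BirchSwinnertonDyer.BirchSwinnertonDyer.Theorems.ResidualThetaTransportAtTwoSignedMuVanishingAtTwoPlusFlatSymbols
import Literature.NumberTheory.EllipticCurves.PAdicLFunctionIntegralityAtTwoAutoProofs
import Literature.NumberTheory.EllipticCurves.PAdicLFunctionIntegralityAtTwoProofs
import Literature.NumberTheory.EllipticCurves.PAdicLFunctionDistributionHoldsProofs
import Literature.NumberTheory.EllipticCurves.PAdicLFunctionInterpolationProofs
import Literature.NumberTheory.EllipticCurves.PAdicLFunctionNeZeroProofs
import Literature.NumberTheory.EllipticCurves.CuspFormTwistRatPlusSymbol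
import HarnessLib

/-!
# Route `ResidualThetaTransportAtTwo`, crux Kμ⁺ `SignedMuVanishingAtTwoPlus` (stmt-BirchSwinnertonDyer-20689), stub `stub_flatMuZeroAtTwo`:
# the PARITY IDENTITY at `2` and a HOMOLOGICAL per-class certificate for FLAT (lead g4's Theorem (R), steps (a)–(b), in the kernel)

Cell `bsd-wall`, width seat `bsd-wall-rtt-p4-w3` (g2). THEOREMS ONLY (no `def`, no named fact, no `sorry`); helper `--supports` the crux;
nothing about any particular curve is asserted; BSD is not proved by this. Inputs BY NAME: the tree's Manin trick at `2`
(`exists_ratPlusSymbol_eq_add_div_two`: `[x]⁺ = [0]⁺ + k/2` when `gcd(den x, N) = 1`; `k` = "Manin index"), the Hecke relation for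
rational plus symbols (`intCast_mul_ratPlusSymbol`), Manin's relation `{∞, γ·0} = {∞, γ∞} + {∞, 0}` (`modularSymbol_gamma0_smul_holds`),
Eichler–Shimura `re Λ_f = ℤ·Ω⁺_f/2` (`plusPeriod_pos_and_realPeriods_eq`), and w3 g0's doors p582978/p578368 (`SignedMuAtTwo.*`).
For a rational newform `f` of ODD level `N` with `a₂(f) = a₂ ∈ ℤ`:
* §1 `two_mul_ratPlusSymbol_quarter_eq`: **`2[1/4]⁺ = (a₂² − 2a₂ − 1)·[0]⁺`** (second Hecke step at `2`, cusp `1/2`).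
* §2 `exists_int_eq_mul_ratPlusSymbol_zero`: **`(a₂ − 3)(a₂ + 1)·[0]⁺ =` the Manin index of `1/4` `∈ ℤ`**; `a₂ = 0`: `3·L(f,1)/Ω⁺_f ∈ ℤ`
  (`exists_int_eq_three_mul_ratPlusSymbol_zero[_of_goodSS]`) — upgrading the tree's `(a₂ − 3)[0]⁺ ∈ ½ℤ`.
* §3 (even `a₂`, e.g. supersingular at `2`) `norm_two_mul_ratPlusSymbol_le_one_and_eq_one_iff`: **`2[x]⁺ ∈ ℤ₍₂₎` and `|2[x]⁺|₂ = 1 ⟺`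
  the Manin index of `x` is ODD**; `supNorm_mazurTateElement_le_one`: EVERY Mazur–Tate layer at `2` is `2`-integral (no Pollack pair);
  `supNorm_mazurTateElement_eq_one_iff_exists_odd_maninIndex`; **`not_two_dvd_flat_iff_exists_odd_maninIndex`: FLAT ⟺ some even layer
  carries a symbol `5^s/2^{n+2}` with odd Manin index** (the lead's (3), kernel form).
* §4 `ratPlusSymbol_cusp_sub_zero_eq` / `exists_cuspPeriodIndex`: the Manin index of `γ·0 = b/d` (`γ = (a b; c d) ∈ Γ₀(N)`) IS the
  cusp-period index `2·re{∞, γ∞}_f/Ω⁺_f ∈ ℤ` — mod `2` the class `χ_f ∈ H¹(X₀(N); 𝔽₂)` on `[γ]`; `exists_gamma0_entries` (Bezout).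
* §5–§6 `not_two_dvd_flat_of_odd_maninIndex` / `…_of_odd_cuspPeriodIndex`, habitat forms `flatAt_of_odd_*` (`GoodSS W 2`, `a₂(W) = 0`,
  newform `f`): **FLAT-at-`(W,f)` ⟸ ONE `γ ∈ Γ₀(N)` with `γ·0 = 5^s/2^{n+2}` (`n` even) and odd cusp-period index** — exact integer linear
  algebra on Manin symbols, no period, no floating point; the layer-`0` certificate «`L(W,1)/Ω` odd» is the case `γ·0 = 1/4`.

References: B. Mazur, J. Tate, J. Teitelbaum, Invent. Math. 84 (1986) §I.4 (4.2), §I.8 [MazurTateTeitelbaum1986Invent]; Ju. I. Manin,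
Izv. AN SSSR 36 (1972) Prop. 1.4, Thm. 1.6 [Manin1972]; J. E. Cremona, *Algorithms for modular elliptic curves* (1997) §2.8
[CremonaAlgorithms1997]; R. Pollack, Duke Math. J. 118 (2003) Prop. 6.18 [Pollack2003]; R. Pollack, T. Weston, Duke Math. J. 156 (2011)
§3.1 [PollackWeston2011MT]; lead memo Cruxes/SignedMuVanishingAtTwoPlus/FlatCuspSpan.md §2 (rtt-p4 g4, 2026-08-28).
-/

set_option autoImplicit false
set_option linter.dupNamespace false

noncomputable section

open scoped Classical MatrixGroups ModularForm

open CongruenceSubgroup WeierstrassCurve Literature.NumberTheory.EllipticCurves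
  Literature.NumberTheory.EllipticCurves.ModularForms Literature.NumberTheory.EllipticCurves.IwasawaAlgebra
  Literature.NumberTheory.EllipticCurves.Rank1Residual
  Summit.BirchSwinnertonDyer.Rank1Residual.Supersingular Summit.BirchSwinnertonDyer.Rank1Residual.X1

namespace Summit.BirchSwinnertonDyer.BirchSwinnertonDyer.Theorems.FlatParityAtTwo

section Symbols

variable {N : ℕ} [NeZero N] {f : CuspForm (Gamma0 N) 2}

/-! ## §1. The second Hecke step at `2`: `2[1/4]⁺ = (a₂² − 2a₂ − 1)[0]⁺` -/

/-- `[3/4]⁺ = [1/4]⁺` (`3/4 = −1/4 + 1`; the plus symbol is even and `1`-periodic). [cite: MazurTateTeitelbaum1986Invent, §I.8] -/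
theorem ratPlusSymbol_three_quarters : ratPlusSymbol f (3 / 4) = ratPlusSymbol f (1 / 4) := by
  have h : (3 / 4 : ℚ) = -(1 / 4) + ((1 : ℤ) : ℚ) := by norm_num
  rw [h, ratPlusSymbol_add_intCast_holds (f := f), ratPlusSymbol_neg]

/-- **First Hecke step at `2`** (cusp `0`): `[1/2]⁺ = (a₂ − 2)·[0]⁺` for a rational newform of odd level with `a₂(f) = a₂`.
[cite: MazurTateTeitelbaum1986Invent, §I.4 (4.2)] -/
theorem ratPlusSymbol_half_eq (hf : IsNewform0 f) (hQ : coeffField f = ⊥) (h2N : ¬ 2 ∣ N) {a₂ : ℤ}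
    (ha₂ : cuspCoeff f 2 = a₂) : ratPlusSymbol f (1 / 2) = ((a₂ : ℚ) - 2) * ratPlusSymbol f 0 := by
  have h := intCast_mul_ratPlusSymbol 2 hf Nat.prime_two h2N ha₂ (ratCast_ratPlusSymbol_holds hf hQ) 0
  rw [Fin.sum_univ_two] at h
  simp only [Fin.val_zero, Fin.val_one, Nat.cast_zero, Nat.cast_one, zero_add, zero_div, mul_zero, Nat.cast_ofNat] at h
  linarith

/-- **Second Hecke step at `2`** (cusp `1/2`): `a₂[1/2]⁺ = [1/4]⁺ + [3/4]⁺ + [1]⁺ = 2[1/4]⁺ + [0]⁺`, so `2[1/4]⁺ = (a₂² − 2a₂ − 1)[0]⁺`.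
[cite: MazurTateTeitelbaum1986Invent, §I.4 (4.2)] -/
theorem two_mul_ratPlusSymbol_quarter_eq (hf : IsNewform0 f) (hQ : coeffField f = ⊥) (h2N : ¬ 2 ∣ N) {a₂ : ℤ}
    (ha₂ : cuspCoeff f 2 = a₂) :
    2 * ratPlusSymbol f (1 / 4) = ((a₂ : ℚ) ^ 2 - 2 * a₂ - 1) * ratPlusSymbol f 0 := by
  have h := intCast_mul_ratPlusSymbol 2 hf Nat.prime_two h2N ha₂ (ratCast_ratPlusSymbol_holds hf hQ) (1 / 2)
  rw [Fin.sum_univ_two] at h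
  simp only [Fin.val_zero, Fin.val_one, Nat.cast_zero, Nat.cast_one, add_zero, Nat.cast_ofNat] at h
  have e1 : ((1 / 2 : ℚ)) / 2 = 1 / 4 := by norm_num
  have e2 : ((1 / 2 : ℚ) + 1) / 2 = 3 / 4 := by norm_num
  have e3 : (2 : ℚ) * (1 / 2) = 0 + ((1 : ℤ) : ℚ) := by norm_num
  rw [e1, e2, e3, ratPlusSymbol_add_intCast_holds (f := f), ratPlusSymbol_three_quarters,
    ratPlusSymbol_half_eq hf hQ h2N ha₂] at h
  linarith

/-! ## §2. The parity identity `(a₂ − 3)(a₂ + 1)·[0]⁺ ∈ ℤ` -/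

omit [NeZero N] in
/-- The cusp `c/2^m` has denominator prime to an odd level. [folklore] -/
theorem coprime_den_div_two_pow (h2N : ¬ 2 ∣ N) (c m : ℕ) : Nat.Coprime ((c : ℚ) / (2 : ℚ) ^ m).den N := by
  haveI : Fact (Nat.Prime 2) := ⟨Nat.prime_two⟩
  exact_mod_cast coprime_den_div_prime_pow (p := 2) (N := N) h2N c m

/-- **THE PARITY IDENTITY at `2`**: for a rational newform of ODD level with `a₂(f) = a₂`, the Manin index `k` of the cusp `1/4`
(`[1/4]⁺ = [0]⁺ + k/2`) satisfies **`(a₂ − 3)(a₂ + 1)·[0]⁺ = k`** (lead's (R)(a), identity (2), up to orientation).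
[cite: MazurTateTeitelbaum1986Invent, §I.4 (4.2) and §I.8] [cite: CremonaAlgorithms1997, §2.8] -/
theorem exists_int_eq_mul_ratPlusSymbol_zero (hf : IsNewform0 f) (hQ : coeffField f = ⊥) (h2N : ¬ 2 ∣ N) {a₂ : ℤ}
    (ha₂ : cuspCoeff f 2 = a₂) :
    ∃ k : ℤ, ratPlusSymbol f (1 / 4) = ratPlusSymbol f 0 + (k : ℚ) / 2 ∧
      (((a₂ : ℚ) - 3) * ((a₂ : ℚ) + 1)) * ratPlusSymbol f 0 = k := by
  have hreal : ∀ n, (cuspCoeff f n).im = 0 := cuspCoeff_im_eq_zero_of_coeffField_eq_bot hQ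
  have hx : Nat.Coprime ((1 / 4 : ℚ)).den N := by
    have h := coprime_den_div_two_pow (N := N) h2N 1 2
    have e : ((1 : ℕ) : ℚ) / (2 : ℚ) ^ 2 = 1 / 4 := by norm_num
    rwa [e] at h
  obtain ⟨k, hk⟩ := exists_ratPlusSymbol_eq_add_div_two f hreal hx
  refine ⟨k, hk, ?_⟩
  have h := two_mul_ratPlusSymbol_quarter_eq hf hQ h2N ha₂
  rw [hk] at h
  linear_combination -h

/-- **`a₂ = 0`: `3·[0]⁺_f ∈ ℤ`**, i.e. `L(f,1)/Ω⁺_f ∈ ⅓ℤ` for a rational newform of odd level with `a₂ = 0` (e.g. `19a1`, `27a1`: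
`L/Ω⁺ = 1/3`). [cite: MazurTateTeitelbaum1986Invent, §I.4 (4.2) and §I.8] -/
theorem exists_int_eq_three_mul_ratPlusSymbol_zero (hf : IsNewform0 f) (hQ : coeffField f = ⊥) (h2N : ¬ 2 ∣ N)
    (ha₂ : cuspCoeff f 2 = 0) : ∃ k : ℤ, 3 * ratPlusSymbol f 0 = k := by
  have ha₂' : cuspCoeff f 2 = ((0 : ℤ) : ℂ) := by rw [ha₂, Int.cast_zero]
  obtain ⟨k, -, hk⟩ := exists_int_eq_mul_ratPlusSymbol_zero hf hQ h2N ha₂'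
  refine ⟨-k, ?_⟩
  push_cast at hk ⊢
  linear_combination -hk

/-! ## §3. `2`-integrality and parity of every plus symbol with denominator prime to `N`, for `a₂` even -/

/-- `|z|₂ = 1 ⟺ z` odd, for an integer `z` (the `→`-free half is the tree's `DepletionAtTwo.norm_intCast_eq_one_of_odd`, re-proved
inline to keep this file off that route's import cone). [folklore] -/
theorem padicNorm_intCast_eq_one_iff_odd (z : ℤ) : ‖(z : ℚ_[2])‖ = 1 ↔ Odd z := by
  constructor
  · intro h
    by_contra hodd
    have hlt : ‖(z : ℚ_[2])‖ < 1 := by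
      rw [Padic.norm_intCast_lt_one_iff]
      exact_mod_cast even_iff_two_dvd.mp (Int.not_odd_iff_even.mp hodd)
    exact absurd h hlt.ne
  · intro hz
    refine le_antisymm (Padic.norm_int_le_one z) (not_lt.mp fun h ↦ ?_)
    rw [Padic.norm_intCast_lt_one_iff] at h
    exact (Int.not_even_iff_odd.mpr hz) (even_iff_two_dvd.mpr (by exact_mod_cast h))

/-- **`2[x]⁺ ∈ ℤ₍₂₎` and its parity** (rational newform, odd level, EVEN `a₂`, a cusp `x` with a Manin index `k`: `[x]⁺ = [0]⁺ + k/2`):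
`2[x]⁺ = k + 2k₀/u` with `u = (a₂ − 3)(a₂ + 1)` ODD and `u[0]⁺ = k₀ ∈ ℤ` (§2), so **`|2[x]⁺|₂ ≤ 1`, `= 1` iff `k` is odd**.
[cite: MazurTateTeitelbaum1986Invent, §I.4 (4.2) and §I.8] -/
theorem norm_two_mul_ratPlusSymbol_le_one_and_eq_one_iff (hf : IsNewform0 f) (hQ : coeffField f = ⊥) (h2N : ¬ 2 ∣ N)
    {a₂ : ℤ} (ha₂ : cuspCoeff f 2 = a₂) (heven : Even a₂) {x : ℚ} {k : ℤ}
    (hk : ratPlusSymbol f x = ratPlusSymbol f 0 + (k : ℚ) / 2) :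
    ‖((2 * ratPlusSymbol f x : ℚ) : ℚ_[2])‖ ≤ 1 ∧ (‖((2 * ratPlusSymbol f x : ℚ) : ℚ_[2])‖ = 1 ↔ Odd k) := by
  obtain ⟨k₀, -, hk₀⟩ := exists_int_eq_mul_ratPlusSymbol_zero hf hQ h2N ha₂
  set u : ℤ := (a₂ - 3) * (a₂ + 1) with hu
  have huodd : Odd u := by
    obtain ⟨t, ht⟩ := heven
    refine ⟨2 * t * t - 2 * t - 2, ?_⟩
    rw [hu, ht]; ring
  have hu0' : u ≠ 0 := by
    rintro h
    rw [h] at huodd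
    exact (Int.not_even_iff_odd.mpr huodd) Even.zero
  have hu0 : (u : ℚ) ≠ 0 := by exact_mod_cast hu0'
  have hk₀' : (u : ℚ) * ratPlusSymbol f 0 = k₀ := by rw [hu]; push_cast; exact hk₀
  -- `2[x]⁺ = (u·k + 2k₀)/u`
  have hval : 2 * ratPlusSymbol f x = ((u * k + 2 * k₀ : ℤ) : ℚ) / u := by
    rw [eq_div_iff hu0, hk]
    push_cast
    linear_combination 2 * hk₀'
  have hnormu : ‖((u : ℚ) : ℚ_[2])‖ = 1 := by
    rw [Rat.cast_intCast]; exact (padicNorm_intCast_eq_one_iff_odd u).mpr huodd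
  have hnorm : ‖((2 * ratPlusSymbol f x : ℚ) : ℚ_[2])‖ = ‖((u * k + 2 * k₀ : ℤ) : ℚ_[2])‖ := by
    rw [hval, Rat.cast_div, norm_div, hnormu, div_one, Rat.cast_intCast]
  have hpar : Odd (u * k + 2 * k₀) ↔ Odd k := by
    constructor
    · intro h
      by_contra hk'
      have hke : Even k := Int.not_odd_iff_even.mp hk'
      have : Even (u * k + 2 * k₀) := (hke.mul_left u).add (even_two_mul k₀)
      exact (Int.not_even_iff_odd.mpr h) this
    · intro hko
      exact (huodd.mul hko).add_even (even_two_mul k₀)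
  refine ⟨?_, ?_⟩
  · rw [hnorm]; exact Padic.norm_int_le_one _
  · rw [hnorm, padicNorm_intCast_eq_one_iff_odd, hpar]

/-- **ALL Mazur–Tate coefficients at `2` are `2`-integral** for a rational newform of odd level with even `a₂`: `|2[c/2^m]⁺|₂ ≤ 1`
for every `c`, `m` (no Pollack pair, no `p`-adic `L`-function). [cite: MazurTateTeitelbaum1986Invent, §I.4 (4.2) and §I.8] -/
theorem norm_two_mul_ratPlusSymbol_div_two_pow_le_one (hf : IsNewform0 f) (hQ : coeffField f = ⊥) (h2N : ¬ 2 ∣ N)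
    {a₂ : ℤ} (ha₂ : cuspCoeff f 2 = a₂) (heven : Even a₂) (c m : ℕ) :
    ‖((2 * ratPlusSymbol f ((c : ℚ) / (2 : ℚ) ^ m) : ℚ) : ℚ_[2])‖ ≤ 1 := by
  have hreal : ∀ n, (cuspCoeff f n).im = 0 := cuspCoeff_im_eq_zero_of_coeffField_eq_bot hQ
  obtain ⟨k, hk⟩ := exists_ratPlusSymbol_eq_add_div_two f hreal (coprime_den_div_two_pow (N := N) h2N c m)
  exact (norm_two_mul_ratPlusSymbol_le_one_and_eq_one_iff hf hQ h2N ha₂ heven hk).1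

/-! ## §4. The homological reading: the Manin index of `γ·0` is the cusp-period index `2·re{∞, γ∞}/Ω⁺ ∈ ℤ` -/

/-- `2·re{∞, γ∞}_f = n·Ω⁺_f` with `n ∈ ℤ` for every `γ ∈ Γ₀(N)` and a rational newform `f` (Eichler–Shimura: `re Λ_f = ℤ·Ω⁺/2`).
[cite: CremonaAlgorithms1997, §2.8] [cite: Manin1972, Thm. 1.6] -/
theorem exists_int_two_mul_re_cuspSymbol_eq (hf : IsNewform0 f) (hQ : coeffField f = ⊥) (γ : Gamma0 N) :
    ∃ n : ℤ, 2 * (cuspSymbol f γ).re = n * plusPeriod f := by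
  obtain ⟨-, hre⟩ := plusPeriod_pos_and_realPeriods_eq (isZLattice_periodLattice_holds (f := f)) hf hQ
  have hz : (cuspSymbol f γ).re ∈ realPeriods f := by
    rw [realPeriods, AddSubgroup.mem_map]
    exact ⟨cuspSymbol f γ, cuspSymbol_mem_periodLattice f γ, rfl⟩
  obtain ⟨n, hn⟩ := AddSubgroup.mem_zmultiples_iff.mp (hre ▸ hz)
  exact ⟨n, by rw [← hn, zsmul_eq_mul]; ring⟩

/-- **Manin's relation at the cusp `0`, plus part, normalised**: for `γ = (a b; c d) ∈ Γ₀(N)` with `d ≠ 0` and a rational newform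
`f`: **`[b/d]⁺ − [0]⁺ = re{∞, γ∞}_f / Ω⁺_f`** (`{∞, γ·0} = {∞, γ∞} + {∞, 0}`, real parts, divided by `Ω⁺ > 0`).
[cite: Manin1972, Prop. 1.4 and Thm. 1.6] [cite: CremonaAlgorithms1997, §2.8] -/
theorem ratPlusSymbol_cusp_sub_zero_eq (hf : IsNewform0 f) (hQ : coeffField f = ⊥) (γ : Gamma0 N)
    (hd : ((γ : SL(2, ℤ)) 1 1 : ℚ) ≠ 0) :
    ((ratPlusSymbol f ((((γ : SL(2, ℤ)) 0 1 : ℚ)) / ((γ : SL(2, ℤ)) 1 1 : ℚ)) - ratPlusSymbol f 0 : ℚ) : ℝ) =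
      (cuspSymbol f γ).re / plusPeriod f := by
  have hΩ : 0 < plusPeriod f := IsNewform0.plusPeriod_pos_holds hf hQ
  have hreal : ∀ n, (cuspCoeff f n).im = 0 := cuspCoeff_im_eq_zero_of_coeffField_eq_bot hQ
  have hmanin := modularSymbol_gamma0_smul_holds f γ 0 (by rw [mul_zero, zero_add]; exact hd)
  rw [mul_zero, zero_add, mul_zero, zero_add] at hmanin
  have hx := ratCast_ratPlusSymbol_mul_plusPeriod f hf hQ ((((γ : SL(2, ℤ)) 0 1 : ℚ)) / ((γ : SL(2, ℤ)) 1 1 : ℚ))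
  have h0 := ratCast_ratPlusSymbol_mul_plusPeriod f hf hQ 0
  rw [plusSymbol_eq_re_of f (modularSymbol_neg_eq_conj_holds f) hreal] at hx h0
  rw [hmanin, Complex.add_re] at hx
  have hxR : ((ratPlusSymbol f ((((γ : SL(2, ℤ)) 0 1 : ℚ)) / ((γ : SL(2, ℤ)) 1 1 : ℚ)) : ℚ) : ℝ) * plusPeriod f =
      (cuspSymbol f γ).re + (modularSymbol f 0).re := by exact_mod_cast hx
  have h0R : ((ratPlusSymbol f 0 : ℚ) : ℝ) * plusPeriod f = (modularSymbol f 0).re := by exact_mod_cast h0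
  rw [eq_div_iff hΩ.ne']
  push_cast
  linear_combination hxR - h0R

/-- **The Manin index IS the cusp-period index**: for `γ = (a b; c d) ∈ Γ₀(N)`, `d ≠ 0`, `f` a rational newform, the integer `n`
with `2·re{∞, γ∞} = n·Ω⁺` satisfies `[b/d]⁺ = [0]⁺ + n/2` (so `k_{b/d} ≡ χ̃_f(γ)`; mod `2` this is the class `χ_f ∈ H¹(X₀(N); 𝔽₂)`
evaluated on `[γ]`). [cite: Manin1972, Prop. 1.4 and Thm. 1.6] [cite: CremonaAlgorithms1997, §2.8] -/
theorem exists_cuspPeriodIndex (hf : IsNewform0 f) (hQ : coeffField f = ⊥) (γ : Gamma0 N)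
    (hd : ((γ : SL(2, ℤ)) 1 1 : ℚ) ≠ 0) :
    ∃ n : ℤ, 2 * (cuspSymbol f γ).re = n * plusPeriod f ∧
      ratPlusSymbol f ((((γ : SL(2, ℤ)) 0 1 : ℚ)) / ((γ : SL(2, ℤ)) 1 1 : ℚ)) = ratPlusSymbol f 0 + (n : ℚ) / 2 := by
  obtain ⟨n, hn⟩ := exists_int_two_mul_re_cuspSymbol_eq hf hQ γ
  refine ⟨n, hn, ?_⟩
  have hΩ : 0 < plusPeriod f := IsNewform0.plusPeriod_pos_holds hf hQ
  have h := ratPlusSymbol_cusp_sub_zero_eq hf hQ γ hd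
  have h2 : (cuspSymbol f γ).re / plusPeriod f = (n : ℝ) / 2 := by
    rw [div_eq_div_iff hΩ.ne' two_ne_zero]
    linear_combination hn
  rw [h2] at h
  have h3 : ((ratPlusSymbol f ((((γ : SL(2, ℤ)) 0 1 : ℚ)) / ((γ : SL(2, ℤ)) 1 1 : ℚ)) - ratPlusSymbol f 0 : ℚ) : ℝ) =
      (((n : ℚ) / 2 : ℚ) : ℝ) := by rw [h]; push_cast; ring
  have h4 := Rat.cast_injective (α := ℝ) h3
  linear_combination h4

omit [NeZero N] in
/-- **A matrix of `Γ₀(N)` moving `0` to a prescribed `2`-power cusp**: for `N` odd, `c` odd and `m ≥ 0` there is `γ ∈ Γ₀(N)` with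
upper-right entry `c` and lower-right entry `2^m` (Bezout for `gcd(2^m, cN) = 1`). [folklore] -/
theorem exists_gamma0_entries (hN : Odd N) {c : ℤ} (hc : Odd c) (m : ℕ) :
    ∃ γ : Gamma0 N, (γ : SL(2, ℤ)) 0 1 = c ∧ (γ : SL(2, ℤ)) 1 1 = 2 ^ m := by
  have hcN : Odd (c * N) := hc.mul (by exact_mod_cast hN)
  obtain ⟨t, ht⟩ := hcN
  have h2 : IsCoprime (2 : ℤ) (c * N) := ⟨-t, 1, by linear_combination ht⟩
  obtain ⟨x, y, hxy⟩ := (h2.pow_left (m := m))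
  let A : SL(2, ℤ) := ⟨!![x, c; -(y * N), 2 ^ m], by
    rw [Matrix.det_fin_two_of]; linear_combination hxy⟩
  have hA : A ∈ Gamma0 N := by
    rw [Gamma0_mem]; show (((-(y * (N : ℤ))) : ℤ) : ZMod N) = 0; push_cast; simp
  exact ⟨⟨A, hA⟩, rfl, rfl⟩

/-- **A Mazur–Tate layer at `2` has a unit coefficient ⟺ ONE of its symbols `5^s/2^{n+2}` has an odd Manin index** (rational newform,
odd level, even `a₂`; w3's `‖θ_n(f)‖_sup = max_s |2[5^s/2^{n+2}]⁺|₂` + §3). [cite: PollackWeston2011MT, §3.1] [cite: MazurTateTeitelbaum1986Invent, §I.8] -/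
theorem supNorm_mazurTateElement_eq_one_iff_exists_odd_maninIndex (hf : IsNewform0 f) (hQ : coeffField f = ⊥)
    (h2N : ¬ 2 ∣ N) {a₂ : ℤ} (ha₂ : cuspCoeff f 2 = a₂) (heven : Even a₂) (n : ℕ) :
    ((mazurTateElement f 2 n).map (algebraMap ℚ (PadicAlgCl 2))).supNorm = 1 ↔
      ∃ (s : ZMod (2 ^ n)) (k : ℤ), Odd k ∧
        ratPlusSymbol f ((((cyclotomicGenerator 2 : ZMod (2 ^ (n + 2))) ^ s.val).val : ℚ) / (2 : ℚ) ^ (n + 2)) =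
          ratPlusSymbol f 0 + (k : ℚ) / 2 := by
  have hreal : ∀ m, (cuspCoeff f m).im = 0 := cuspCoeff_im_eq_zero_of_coeffField_eq_bot hQ
  have hk : ∀ t : ZMod (2 ^ n), ∃ k : ℤ,
      ratPlusSymbol f ((((cyclotomicGenerator 2 : ZMod (2 ^ (n + 2))) ^ t.val).val : ℚ) / (2 : ℚ) ^ (n + 2)) =
        ratPlusSymbol f 0 + (k : ℚ) / 2 := fun t ↦
    exists_ratPlusSymbol_eq_add_div_two f hreal (coprime_den_div_two_pow (N := N) h2N _ (n + 2))
  obtain ⟨t, ht⟩ := SignedMuAtTwo.exists_supNorm_eq_norm_two_mul_ratPlusSymbol f n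
  constructor
  · intro h1
    obtain ⟨k, hkt⟩ := hk t
    refine ⟨t, k, ?_, hkt⟩
    rw [h1] at ht
    exact (norm_two_mul_ratPlusSymbol_le_one_and_eq_one_iff hf hQ h2N ha₂ heven hkt).2.mp ht.symm
  · rintro ⟨s, k, hodd, hks⟩
    have h1 := (norm_two_mul_ratPlusSymbol_le_one_and_eq_one_iff hf hQ h2N ha₂ heven hks).2.mpr hodd
    refine le_antisymm ?_ (h1 ▸ SignedMuAtTwo.norm_two_mul_ratPlusSymbol_le_supNorm f n s)
    obtain ⟨k', hk'⟩ := hk t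
    rw [ht]
    exact (norm_two_mul_ratPlusSymbol_le_one_and_eq_one_iff hf hQ h2N ha₂ heven hk').1

/-- **Every Mazur–Tate layer at `2` is `2`-integral**: `‖θ_n(f)‖_sup ≤ 1` for ALL `n` (rational newform, odd level, even `a₂`;
no Pollack pair). [cite: MazurTateTeitelbaum1986Invent, §I.4 (4.2) and §I.8] [cite: PollackWeston2011MT, §3.1] -/
theorem supNorm_mazurTateElement_le_one (hf : IsNewform0 f) (hQ : coeffField f = ⊥) (h2N : ¬ 2 ∣ N) {a₂ : ℤ}
    (ha₂ : cuspCoeff f 2 = a₂) (heven : Even a₂) (n : ℕ) :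
    ((mazurTateElement f 2 n).map (algebraMap ℚ (PadicAlgCl 2))).supNorm ≤ 1 := by
  obtain ⟨t, ht⟩ := SignedMuAtTwo.exists_supNorm_eq_norm_two_mul_ratPlusSymbol f n
  rw [ht]
  exact norm_two_mul_ratPlusSymbol_div_two_pow_le_one hf hQ h2N ha₂ heven _ (n + 2)

end Symbols

section Flat

variable {N : ℕ} [NeZero N] {f : CuspForm (Gamma0 N) 2} {Lplus Lminus : IwasawaAlgebra 2}

/-- **FLAT ⟸ one odd Manin index**: rational newform of odd level, even `a₂`, a Pollack pair at `2`, an EVEN layer `n`, `s mod 2ⁿ`;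
if `x_s = 5^s/2^{n+2}` has ODD Manin index then `|[x_s]⁺|₂ = 2` and `2 ∤ L♭` (w3's `not_two_dvd_flat_of_two_le_norm_ratPlusSymbol`).
[cite: Pollack2003, Prop. 6.18] [cite: PollackWeston2011MT, §3.1] [cite: MazurTateTeitelbaum1986Invent, §I.4 (4.2) and §I.8] -/
theorem not_two_dvd_flat_of_odd_maninIndex (hf : IsNewform0 f) (hQ : coeffField f = ⊥) (h2N : ¬ 2 ∣ N) {a₂ : ℤ}
    (ha₂ : cuspCoeff f 2 = a₂) (heven : Even a₂) (hP : IsPollackPair f 2 Lplus Lminus) {n : ℕ} (hn : Even n)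
    (s : ZMod (2 ^ n)) {k : ℤ} (hodd : Odd k)
    (hk : ratPlusSymbol f ((((cyclotomicGenerator 2 : ZMod (2 ^ (n + 2))) ^ s.val).val : ℚ) / (2 : ℚ) ^ (n + 2)) =
      ratPlusSymbol f 0 + (k : ℚ) / 2) :
    ¬ PowerSeries.C (2 : ℤ_[2]) ∣ Lminus := by
  have h1 := (norm_two_mul_ratPlusSymbol_le_one_and_eq_one_iff hf hQ h2N ha₂ heven hk).2.mpr hodd
  rw [SignedMuAtTwo.norm_ratCast_two_mul] at h1
  refine SignedMuAtTwo.not_two_dvd_flat_of_two_le_norm_ratPlusSymbol f hP hn (s := s) (le_of_eq ?_)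
  linarith

/-- **FLAT ⟸ one odd cusp-period index** (homological form): same conclusion from a `γ = (a b; c d) ∈ Γ₀(N)` with `b/d = 5^s/2^{n+2}`
and `2·re{∞, γ∞}_f = m·Ω⁺_f`, `m` ODD (§4: the Manin index of `γ·0` is `m`). [cite: Manin1972, Thm. 1.6]
[cite: Pollack2003, Prop. 6.18] [cite: PollackWeston2011MT, §3.1] -/
theorem not_two_dvd_flat_of_odd_cuspPeriodIndex (hf : IsNewform0 f) (hQ : coeffField f = ⊥) (h2N : ¬ 2 ∣ N) {a₂ : ℤ}
    (ha₂ : cuspCoeff f 2 = a₂) (heven : Even a₂) (hP : IsPollackPair f 2 Lplus Lminus) {n : ℕ} (hn : Even n)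
    (s : ZMod (2 ^ n)) (γ : Gamma0 N) (hd : ((γ : SL(2, ℤ)) 1 1 : ℚ) ≠ 0)
    (hγ : (((γ : SL(2, ℤ)) 0 1 : ℚ)) / ((γ : SL(2, ℤ)) 1 1 : ℚ) =
      ((((cyclotomicGenerator 2 : ZMod (2 ^ (n + 2))) ^ s.val).val : ℚ) / (2 : ℚ) ^ (n + 2)))
    {m : ℤ} (hm : 2 * (cuspSymbol f γ).re = m * plusPeriod f) (hodd : Odd m) :
    ¬ PowerSeries.C (2 : ℤ_[2]) ∣ Lminus := by
  obtain ⟨m', hm', hk⟩ := exists_cuspPeriodIndex hf hQ γ hd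
  have hΩ : 0 < plusPeriod f := IsNewform0.plusPeriod_pos_holds hf hQ
  have hmm : (m' : ℝ) = m := by exact_mod_cast mul_right_cancel₀ hΩ.ne' (hm'.symm.trans hm)
  have hmm' : m' = m := by exact_mod_cast hmm
  rw [hγ, hmm'] at hk
  exact not_two_dvd_flat_of_odd_maninIndex hf hQ h2N ha₂ heven hP hn s hodd hk

/-- **FLAT ⟺ some even layer has a symbol with an ODD Manin index** (rational newform, odd level, even `a₂`, a Pollack pair at `2`):
the lead's (3) in the kernel. [cite: Pollack2003, Prop. 6.18] [cite: PollackWeston2011MT, §3.1 and §4] [cite: MazurTateTeitelbaum1986Invent, §I.8] -/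
theorem not_two_dvd_flat_iff_exists_odd_maninIndex (hf : IsNewform0 f) (hQ : coeffField f = ⊥) (h2N : ¬ 2 ∣ N) {a₂ : ℤ}
    (ha₂ : cuspCoeff f 2 = a₂) (heven : Even a₂) (hP : IsPollackPair f 2 Lplus Lminus) :
    ¬ PowerSeries.C (2 : ℤ_[2]) ∣ Lminus ↔
      ∃ n : ℕ, Even n ∧ ∃ (s : ZMod (2 ^ n)) (k : ℤ), Odd k ∧
        ratPlusSymbol f ((((cyclotomicGenerator 2 : ZMod (2 ^ (n + 2))) ^ s.val).val : ℚ) / (2 : ℚ) ^ (n + 2)) =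
          ratPlusSymbol f 0 + (k : ℚ) / 2 := by
  rw [SignedMuAtTwo.not_two_dvd_flat_iff_exists_supNorm_mazurTateElement_eq_one f hP]
  refine exists_congr fun n ↦ and_congr_right fun _ ↦ ?_
  exact supNorm_mazurTateElement_eq_one_iff_exists_odd_maninIndex hf hQ h2N ha₂ heven n

end Flat

section Habitat

variable {W : WeierstrassCurve ℚ} [W.IsElliptic] [W.IsGloballyMinimal] {N : ℕ} [NeZero N]
  {f : CuspForm (Gamma0 N) 2} {Lplus Lminus : IwasawaAlgebra 2}

/-- **`3·[0]⁺_f ∈ ℤ` for the newform of a curve good supersingular at `2` with `a₂ = 0`** (`2 ∤ N` from good reduction,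
`a₂(f) = a₂(W) = 0`). [cite: MazurTateTeitelbaum1986Invent, §I.4 (4.2) and §I.8] -/
theorem exists_int_eq_three_mul_ratPlusSymbol_zero_of_goodSS (hf : IsNewformOf W f) (hss : GoodSS W 2)
    (ha : W.frobeniusTrace 2 = 0) : ∃ k : ℤ, 3 * ratPlusSymbol f 0 = k := by
  have h2N : ¬ 2 ∣ N := not_dvd_level_of_isNewformOf hf hss.1
  have ha₂ : cuspCoeff f 2 = 0 := by
    rw [cuspCoeff_eq_frobeniusTrace_of_isNewformOf_holds hf hss.1, ha, Int.cast_zero]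
  exact exists_int_eq_three_mul_ratPlusSymbol_zero hf.1 hf.coeffField_eq_bot h2N ha₂

/-- **FLAT-at-`(W, f)` from ONE odd Manin index** on the habitat (`GoodSS W 2`, `a₂(W) = 0`, `f` the newform of `W`): for every
Pollack pair at `2`, an even layer `n`, a residue `5^s mod 2^{n+2}` and an ODD `k` with `[5^s/2^{n+2}]⁺_f = [0]⁺_f + k/2`: `2 ∤ L♭`.
[cite: Pollack2003, Prop. 6.18] [cite: PollackWeston2011MT, §3.1] [cite: MazurTateTeitelbaum1986Invent, §I.4 (4.2) and §I.8] -/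
theorem flatAt_of_odd_maninIndex (hf : IsNewformOf W f) (hss : GoodSS W 2) (ha : W.frobeniusTrace 2 = 0)
    (hP : IsPollackPair f 2 Lplus Lminus) {n : ℕ} (hn : Even n) (s : ZMod (2 ^ n)) {k : ℤ} (hodd : Odd k)
    (hk : ratPlusSymbol f ((((cyclotomicGenerator 2 : ZMod (2 ^ (n + 2))) ^ s.val).val : ℚ) / (2 : ℚ) ^ (n + 2)) =
      ratPlusSymbol f 0 + (k : ℚ) / 2) :
    ¬ PowerSeries.C (2 : ℤ_[2]) ∣ Lminus := by
  have h2N : ¬ 2 ∣ N := not_dvd_level_of_isNewformOf hf hss.1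
  have ha₂ : cuspCoeff f 2 = ((0 : ℤ) : ℂ) := by
    rw [cuspCoeff_eq_frobeniusTrace_of_isNewformOf_holds hf hss.1, ha]
  exact not_two_dvd_flat_of_odd_maninIndex hf.1 hf.coeffField_eq_bot h2N ha₂ Even.zero hP hn s hodd hk

/-- **FLAT-at-`(W, f)` from ONE odd cusp-period index** (homological form on the habitat): a `γ ∈ Γ₀(N)` with
`γ·0 = 5^s/2^{n+2}` (`n` even) and `2·re{∞, γ∞}_f/Ω⁺_f` ODD certifies `2 ∤ L♭` for every Pollack pair at `2`.
[cite: Manin1972, Thm. 1.6] [cite: Pollack2003, Prop. 6.18] [cite: PollackWeston2011MT, §3.1] -/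
theorem flatAt_of_odd_cuspPeriodIndex (hf : IsNewformOf W f) (hss : GoodSS W 2) (ha : W.frobeniusTrace 2 = 0)
    (hP : IsPollackPair f 2 Lplus Lminus) {n : ℕ} (hn : Even n) (s : ZMod (2 ^ n)) (γ : Gamma0 N)
    (hd : ((γ : SL(2, ℤ)) 1 1 : ℚ) ≠ 0)
    (hγ : (((γ : SL(2, ℤ)) 0 1 : ℚ)) / ((γ : SL(2, ℤ)) 1 1 : ℚ) =
      ((((cyclotomicGenerator 2 : ZMod (2 ^ (n + 2))) ^ s.val).val : ℚ) / (2 : ℚ) ^ (n + 2)))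
    {m : ℤ} (hm : 2 * (cuspSymbol f γ).re = m * plusPeriod f) (hodd : Odd m) :
    ¬ PowerSeries.C (2 : ℤ_[2]) ∣ Lminus := by
  have h2N : ¬ 2 ∣ N := not_dvd_level_of_isNewformOf hf hss.1
  have ha₂ : cuspCoeff f 2 = ((0 : ℤ) : ℂ) := by
    rw [cuspCoeff_eq_frobeniusTrace_of_isNewformOf_holds hf hss.1, ha]
  exact not_two_dvd_flat_of_odd_cuspPeriodIndex hf.1 hf.coeffField_eq_bot h2N ha₂ Even.zero hP hn s γ hd hγ hm hodd

end Habitat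

end Summit.BirchSwinnertonDyer.BirchSwinnertonDyer.Theorems.FlatParityAtTwo

end
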